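import Mathlib
import HarnessLib
import Summits.AtomisticToContinuum.FouriersLaw.Theses.BondHeatUncertainty
import Literature.MathematicalPhysics.KineticTheory.LangevinChainKernel
import Literature.MathematicalPhysics.KineticTheory.LangevinChainGibbs

/-!
# Sketch — first lemmas of three crux ideas for `LinearResponseFTUR` (stmt-AtomisticToContinuum-9122)

Ideator 2, round 1. Each `def … : Prop` is the FIRST CHECKABLE STATEMENT of one line; nothing is
proved here. All constants are existing declarations (`pinnedChain`, `IsSteadyState`,
`totalCurrent`, `partialP`, `partialQ`, `hamiltonian`, `gibbsMeasure`, `transitionKernel`,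
`solMap`, `wienerPair`, `pairPath`).
-/

noncomputable section

namespace Summit.AtomisticToContinuum.FouriersLaw.Cruxes.LinearResponseFTUR.SketchIdeator2

open MeasureTheory Literature.MathematicalPhysics.KineticTheory.HeatConduction
open Literature.Probability.Process
open scoped ContDiff NNReal ENNReal

/-! ## Card A — boundary Fisher information (`boundary-fisher-entropy-balance`) -/

/-- **A1. Kinetic Fisher sum rule.** For every weak steady state `μ = ρ dx` of the pinned chain
(`N ≥ 1`, any bath temperatures) with a smooth positive bounded density and an exponential energy
moment, the Fisher informations of `ρ` in the two THERMOSTATTED momenta are finite and satisfy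
`T_L ∫ (∂_{p_0} log ρ)² dμ + T_R ∫ (∂_{p_{N-1}} log ρ)² dμ = 2`
(for `N = 1` both baths sit on the single site and the two integrals coincide). Proof sketch:
test the weak stationarity `∫ L f dμ = 0` against `f = χ_R² log ρ` (a legitimate `C_c^∞` test
function: `log ρ` is smooth), absorb the cross term Caccioppoli-style, let `R → ∞` using the
exponential moment. -/
def KineticFisherSumRule : Prop :=
  ∀ ω₂ lam β γ : ℝ, 0 < ω₂ → 0 < lam → 0 < β → 0 < γ →
  ∀ (N : ℕ) (hN : 1 ≤ N) (T_L T_R : ℝ), 0 < T_L → 0 < T_R →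
  ∀ (μ : Measure (PhaseSpace N)) (ρ : PhaseSpace N → ℝ),
    (pinnedChain ω₂ lam β γ).IsSteadyState N T_L T_R μ →
    ContDiff ℝ ∞ ρ → (∀ x, 0 < ρ x) → BddAbove (Set.range ρ) →
    μ = volume.withDensity (fun x => ENNReal.ofReal (ρ x)) →
    (∃ θ : ℝ, 0 < θ ∧
      Integrable (fun x => Real.exp (θ * (pinnedChain ω₂ lam β γ).hamiltonian N x)) μ) →
    let i0 : Fin N := ⟨0, hN⟩
    let iN : Fin N := ⟨N - 1, Nat.sub_lt hN Nat.one_pos⟩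
    Integrable (fun x => (partialP i0 (fun y => Real.log (ρ y)) x) ^ 2) μ ∧
    Integrable (fun x => (partialP iN (fun y => Real.log (ρ y)) x) ^ 2) μ ∧
    T_L * ∫ x, (partialP i0 (fun y => Real.log (ρ y)) x) ^ 2 ∂μ +
      T_R * ∫ x, (partialP iN (fun y => Real.log (ρ y)) x) ^ 2 ∂μ = 2

/-- **A2. Finite-`δ` Clausius inequality** (part (a) of the crux before the limit, with no
path space): under weak-NESS uniqueness, along every steady-state family the total current has
the sign of `T_L - T_R`. Proof sketch: `σ_thermo = J (1/T_R - 1/T_L)` equals the boundary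
relative Fisher information `∑_b γ T_b ∫ |∂_{p_b} log (ρ/M_{T_b})|² dμ ≥ 0` by A1 and the energy
balance `∫ L H dμ = 0`. -/
def FiniteDeltaClausius : Prop :=
  ∀ ω₂ lam β γ : ℝ, 0 < ω₂ → 0 < lam → 0 < β → 0 < γ →
  (∀ (N : ℕ) (T_L T_R : ℝ), 0 < T_L → 0 < T_R → ∀ μ ν : Measure (PhaseSpace N),
    (pinnedChain ω₂ lam β γ).IsSteadyState N T_L T_R μ →
    (pinnedChain ω₂ lam β γ).IsSteadyState N T_L T_R ν → μ = ν) →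
  ∀ μ : (N : ℕ) → ℝ → ℝ → Measure (PhaseSpace N),
    (∀ (N : ℕ) (T_L T_R : ℝ), 0 < T_L → 0 < T_R →
      (pinnedChain ω₂ lam β γ).IsSteadyState N T_L T_R (μ N T_L T_R)) →
  ∀ (N : ℕ) (T_L T_R : ℝ), 0 < T_L → 0 < T_R →
    0 ≤ (T_L - T_R) * (pinnedChain ω₂ lam β γ).totalCurrent (μ N T_L T_R)

/-! ## Card B — equilibrium score Cauchy–Schwarz (`equilibrium-score-cauchy-schwarz`) -/

/-- **B1. Gibbs detailed balance modulo momentum flip for the constructed kernel.** At equal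
bath temperatures the stationary Gibbs process is invariant under time reversal composed with
`Θ(q,p) = (q,-p)`; at the level of the constructed transition kernel and bounded observables:
`E_{μ_T}[g(z) · (P_s f)(z)] = E_{μ_T}[f(Θ z) · (P_s (g ∘ Θ))(z)]`. This `Θ̃`-invariance of the
equilibrium path law is the structural input that kills every even term in the `δ`-expansion. -/
def GibbsFlipDetailedBalance : Prop :=
  ∀ ω₂ lam β γ : ℝ, 0 < ω₂ → 0 < lam → 0 < β → 0 < γ → ∀ (N : ℕ) (T : ℝ), 0 < T →
  ∀ (s : ℝ≥0) (f g : PhaseSpace N → ℝ), Measurable f → Measurable g →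
    (∃ C : ℝ, ∀ x, |f x| ≤ C) → (∃ C : ℝ, ∀ x, |g x| ≤ C) →
    ∫ z, g z * (∫ y, f y ∂((pinnedChain ω₂ lam β γ).transitionKernel N T T s z))
        ∂((pinnedChain ω₂ lam β γ).gibbsMeasure N T) =
      ∫ z, f (z.1, -z.2) * (∫ y, g (y.1, -y.2) ∂((pinnedChain ω₂ lam β γ).transitionKernel N T T s z))
        ∂((pinnedChain ω₂ lam β γ).gibbsMeasure N T)

/-! ## Card C — Lebesgue flip-duality / anti-damped Girsanov (`lebesgue-flip-duality`) -/

/-- **C1. Exponential heat sum rule.** For `N ≥ 2` and EVERY initial point `z`, the heats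
`Q_L, Q_R` absorbed from the two baths on `[0,t]` along the pathwise solution
(`Q_b = Δ(p_b²/2) + ∫₀ᵗ p_b ∂_{q_b}H ds`, no stochastic integral) satisfy
`E_z[exp(Q_L/T_L + Q_R/T_R)] = e^{2γt}`. Content: `e^{Q_b/T_b} = e^{γt} ℰ(∫ √(2γ/T_b) p_b dW_b)`
pathwise, and the stochastic exponential is a TRUE martingale because the Girsanov-tilted dynamics
is the ANTI-damped chain (friction `+γ p_b`), which does not explode. -/
def ExponentialHeatSumRule : Prop :=
  ∀ ω₂ lam β γ : ℝ, 0 < ω₂ → 0 < lam → 0 < β → 0 < γ →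
  ∀ (N : ℕ) (hN : 2 ≤ N) (T_L T_R : ℝ), 0 < T_L → 0 < T_R → ∀ t : ℝ, 0 ≤ t →
  ∀ z : PhaseSpace N,
    let P := pinnedChain ω₂ lam β γ
    let i0 : Fin N := ⟨0, by omega⟩
    let iN : Fin N := ⟨N - 1, by omega⟩
    let X : ℝ → WienerPair → PhaseSpace N := fun s w => P.solMap N T_L T_R s z (pairPath w)
    let Q : Fin N → WienerPair → ℝ := fun i w =>
      (X t w).2 i ^ 2 / 2 - z.2 i ^ 2 / 2 +
        ∫ s in (0 : ℝ)..t, (X s w).2 i * partialQ i (P.hamiltonian N) (X s w)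
    ∫ w, Real.exp (Q i0 w / T_L + Q iN w / T_R) ∂wienerPair = Real.exp (2 * γ * t)

/-- **C2. Flip-duality of the transition kernels with the exponential heat weight** (two-time
marginal of the generalised detailed balance `Θ̃_* R = exp(∑_b Q_b/T_b) · R` of the σ-finite
path measure `R = ∫ dz P_z`; the two-bath generalisation of the one-bath kernel identity
`p_t(x,y)/p_t(Θy,Θx) = e^{β(W-ΔE)}`): for bounded measurable `f, g ≥ 0`,
`∫ dz f(Θz) E_z[g(Θ x_t)] = ∫ dz g(z) E_z[e^{Q_L/T_L + Q_R/T_R} f(x_t)]`. Multiplying by the NESS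
density at time `0` gives `dP_δ/dΘ̃_*P_δ = ρ_δ(x_0)/ρ_δ(Θx_t) · e^{-∑ Q_b/T_b}` and hence
`⟨Σ_t⟩ = KL(μ_δ‖Θ_*μ_δ) + t σ_thermo` exactly. -/
def HeatWeightedFlipDuality : Prop :=
  ∀ ω₂ lam β γ : ℝ, 0 < ω₂ → 0 < lam → 0 < β → 0 < γ →
  ∀ (N : ℕ) (hN : 2 ≤ N) (T_L T_R : ℝ), 0 < T_L → 0 < T_R → ∀ t : ℝ≥0,
  ∀ f g : PhaseSpace N → ℝ, Measurable f → Measurable g → (∀ x, 0 ≤ f x) → (∀ x, 0 ≤ g x) →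
    (∃ C : ℝ, ∀ x, f x ≤ C) → (∃ C : ℝ, ∀ x, g x ≤ C) →
    let P := pinnedChain ω₂ lam β γ
    let i0 : Fin N := ⟨0, by omega⟩
    let iN : Fin N := ⟨N - 1, by omega⟩
    let X : ℝ → PhaseSpace N → WienerPair → PhaseSpace N :=
      fun s z w => P.solMap N T_L T_R s z (pairPath w)
    let Q : Fin N → PhaseSpace N → WienerPair → ℝ := fun i z w =>
      (X t z w).2 i ^ 2 / 2 - z.2 i ^ 2 / 2 +
        ∫ s in (0 : ℝ)..t, (X s z w).2 i * partialQ i (P.hamiltonian N) (X s z w)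
    ∫⁻ z, ENNReal.ofReal (f (z.1, -z.2)) *
        (∫⁻ y, ENNReal.ofReal (g (y.1, -y.2)) ∂(P.transitionKernel N T_L T_R t z)) =
      ∫⁻ z, ENNReal.ofReal (g z) *
        ∫⁻ w, ENNReal.ofReal (Real.exp (Q i0 z w / T_L + Q iN z w / T_R) * f (X t z w)) ∂wienerPair

end Summit.AtomisticToContinuum.FouriersLaw.Cruxes.LinearResponseFTUR.SketchIdeator2

end
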